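import Mathlib
import Literature.Computability.Cryptography.QuantumCircuitProofs

/-!
# Bessel on the isometric sub-flattening — the robustness lever for crux `FlatteningBoundRobust`

Crux workfile (crux-ideate round 1, ideator 3; idea card `Ideas/isometric-subflattening-bessel.md`)
for `stmt-QuantumAdvantage-1246` = `Summit.QuantumAdvantage.QuantumAdvantage.Theses.SpinorFlattening.FlatteningBoundRobust`.
This is EVIDENCE for the idea card, not a `Theorems/` proposal and not a crux-plan skeleton: it
machine-checks the card's load-bearing lever in three forms (all sorry-free, standard axioms):

* `bessel_deficiency` — an orthonormal family of `#ι` vectors cannot be approximated from inside a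
  subspace `W` with total squared error below `#ι − dim W` (Pythagoras against the orthogonal
  projection + Parseval in `W` + Bessel's inequality `Orthonormal.sum_inner_products_le`);
* `subflattening_bound` — for linear isometries `U i` with `(U i ψ)_i` orthonormal ("fullness") and
  `U i φ ∈ W` ("deficiency"): `#ι − dim W ≤ #ι · ‖ψ − φ‖²`;
* `subflattening_bound_qreg` — the same in the crux's vocabulary: unitary matrices on
  `QReg n → ℂ`, the tree's `normSq`, the Gram condition `star (U i ψ) ⬝ᵥ (U j ψ) = δ_ij`, and a
  `Submodule ℂ (QReg n → ℂ)` containing every `U i φ`.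

How crux 1246 (and the stronger transfer C⁺ of the card) follows: take `ι` = one-per-block
Clifford monomials `c_S` (`K` distinct blocks, one Jordan–Wigner Majorana in each;
`#ι = C(t,K)·8^K`, each `c_S` unitary by `GaussianRank.majorana_mem_unitaryGroup`), `ψ = |M⟩^{⊗t}`
(Gram condition = the FULLNESS on record), `φ = Σ aᵢ gᵢ`, `W = Σᵢ span{c_T gᵢ : |T| = K}`
(`dim W ≤ r·D_K(4t)` = the DEFICIENCY on record). Then
`C(t,K)8^K − r·D_K(4t) ≤ C(t,K)8^K · normSq(M^{⊗t} − φ)` (= C⁺), and under the crux's hypothesis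
`r·D_K(4t) < C(t,K)8^K ≤ C(8t,K)` this gives `1 ≤ C(8t,K) · normSq(M^{⊗t} − φ)`.
No singular values, operator norms, Mirsky/Eckart–Young or rank–nullity are used anywhere.
-/

set_option linter.dupNamespace false

open scoped InnerProductSpace
open Finset Matrix

namespace Summit.QuantumAdvantage.QuantumAdvantage.Cruxes.FlatteningBoundRobust.BesselSubflattening

/-- **Bessel–deficiency inequality.** For an orthonormal family `u : ι → E`, a subspace `W` and
any `w i ∈ W`: `#ι − dim W ≤ Σ_i ‖u i − w i‖²`. [folklore: Bessel's inequality] -/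
theorem bessel_deficiency {E : Type*} [NormedAddCommGroup E] [InnerProductSpace ℂ E]
    [FiniteDimensional ℂ E] {ι : Type*} [Fintype ι] (u : ι → E) (hu : Orthonormal ℂ u)
    (W : Submodule ℂ E) (w : ι → E) (hw : ∀ i, w i ∈ W) :
    (Fintype.card ι : ℝ) - Module.finrank ℂ W ≤ ∑ i, ‖u i - w i‖ ^ 2 := by
  haveI : CompleteSpace W := FiniteDimensional.complete ℂ W
  set d := Module.finrank ℂ W with hd
  let b : OrthonormalBasis (Fin d) ℂ W := stdOrthonormalBasis ℂ W
  let f : Fin d → E := fun j => (b j : E)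
  have hf1 : ∀ j, ‖f j‖ = 1 := fun j => by
    change ‖((b j : W) : E)‖ = 1
    rw [Submodule.norm_coe]
    exact b.orthonormal.1 j
  -- (1) per-vector bound: ‖u i - w i‖² ≥ 1 - ‖P (u i)‖²
  have h1 : ∀ i, 1 - ‖W.starProjection (u i)‖ ^ 2 ≤ ‖u i - w i‖ ^ 2 := by
    intro i
    have hPy : ‖u i‖ ^ 2 = ‖W.starProjection (u i)‖ ^ 2 + ‖u i - W.starProjection (u i)‖ ^ 2 := by
      rw [Submodule.norm_sq_eq_add_norm_sq_starProjection (u i) W, Submodule.starProjection_orthogonal_val]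
    have hnorm : ‖u i‖ = 1 := hu.1 i
    have horth : ⟪u i - W.starProjection (u i), W.starProjection (u i) - w i⟫_ℂ = 0 :=
      Submodule.inner_left_of_mem_orthogonal (K := W)
        (W.sub_mem (W.starProjection_apply_mem (u i)) (hw i))
        (W.sub_starProjection_mem_orthogonal (u i))
    have hsplit : u i - w i = (u i - W.starProjection (u i)) + (W.starProjection (u i) - w i) := by
      abel
    have hPy2 : ‖u i - w i‖ * ‖u i - w i‖ =
        ‖u i - W.starProjection (u i)‖ * ‖u i - W.starProjection (u i)‖ +
          ‖W.starProjection (u i) - w i‖ * ‖W.starProjection (u i) - w i‖ := by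
      rw [hsplit]
      exact norm_add_sq_eq_norm_sq_add_norm_sq_of_inner_eq_zero _ _ horth
    nlinarith [hPy, hnorm, hPy2, norm_nonneg (W.starProjection (u i) - w i),
      norm_nonneg (u i - w i), norm_nonneg (u i - W.starProjection (u i))]
  -- (2) Parseval inside W: ‖P (u i)‖² = Σ_j ‖⟪f j, u i⟫‖²
  have h2 : ∀ i, ‖W.starProjection (u i)‖ ^ 2 = ∑ j, ‖⟪f j, u i⟫_ℂ‖ ^ 2 := by
    intro i
    have hn : ‖W.starProjection (u i)‖ = ‖b.repr (W.orthogonalProjectionOnto (u i))‖ := by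
      rw [LinearIsometryEquiv.norm_map]
      rfl
    rw [hn, EuclideanSpace.norm_sq_eq]
    refine Finset.sum_congr rfl fun j _ => ?_
    congr 1
    rw [OrthonormalBasis.repr_apply_apply, Submodule.coe_inner]
    -- ⟪f j, P u⟫ = ⟪f j, u⟫
    have h0 := W.starProjection_inner_eq_zero (u i) (f j) (b j).2
    rw [inner_sub_left, sub_eq_zero] at h0
    change ‖⟪f j, W.starProjection (u i)⟫_ℂ‖ = ‖⟪f j, u i⟫_ℂ‖
    rw [norm_inner_symm, ← h0, norm_inner_symm]
  -- (3) Bessel across the orthonormal family u, for each f j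
  have h3 : ∀ j, ∑ i, ‖⟪f j, u i⟫_ℂ‖ ^ 2 ≤ 1 := by
    intro j
    have hB := hu.sum_inner_products_le (s := Finset.univ) (f j)
    rw [hf1 j, one_pow] at hB
    refine le_trans (le_of_eq ?_) hB
    exact Finset.sum_congr rfl fun i _ => by rw [norm_inner_symm]
  -- assemble
  have key : ∑ i, (1 - ∑ j, ‖⟪f j, u i⟫_ℂ‖ ^ 2) ≤ ∑ i, ‖u i - w i‖ ^ 2 :=
    Finset.sum_le_sum fun i _ => by rw [← h2 i]; exact h1 i
  have bound : ∑ i, ∑ j, ‖⟪f j, u i⟫_ℂ‖ ^ 2 ≤ (d : ℝ) := by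
    rw [Finset.sum_comm]
    calc ∑ j, ∑ i, ‖⟪f j, u i⟫_ℂ‖ ^ 2 ≤ ∑ _j : Fin d, (1 : ℝ) := Finset.sum_le_sum fun j _ => h3 j
      _ = d := by simp
  have hsum : ∑ i, (1 - ∑ j, ‖⟪f j, u i⟫_ℂ‖ ^ 2) =
      (Fintype.card ι : ℝ) - ∑ i, ∑ j, ‖⟪f j, u i⟫_ℂ‖ ^ 2 := by
    rw [Finset.sum_sub_distrib]
    simp
  linarith [key, bound, hsum]

/-- THE LEVER, abstract form: a finite family of linear isometries `U i` that sends `ψ` to an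
ORTHONORMAL family (fullness) but sends `φ` into a subspace `W` (deficiency) forces
`#ι − dim W ≤ #ι · ‖ψ − φ‖²`, i.e. `‖ψ − φ‖² ≥ 1 − dim W / #ι` — Bessel on the isometric
sub-flattening; no singular values, no operator norm. -/
theorem subflattening_bound {E : Type*} [NormedAddCommGroup E] [InnerProductSpace ℂ E]
    [FiniteDimensional ℂ E] {ι : Type*} [Fintype ι] (U : ι → E →ₗᵢ[ℂ] E) (ψ φ : E)
    (hψ : Orthonormal ℂ fun i => U i ψ) (W : Submodule ℂ E) (hφ : ∀ i, U i φ ∈ W) :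
    (Fintype.card ι : ℝ) - Module.finrank ℂ W ≤ Fintype.card ι * ‖ψ - φ‖ ^ 2 := by
  have h := bessel_deficiency (fun i => U i ψ) hψ W (fun i => U i φ) hφ
  have hiso : ∀ i, ‖U i ψ - U i φ‖ = ‖ψ - φ‖ := fun i => by
    rw [← map_sub, LinearIsometry.norm_map]
  have hs : ∑ i, ‖U i ψ - U i φ‖ ^ 2 = Fintype.card ι * ‖ψ - φ‖ ^ 2 := by
    rw [Finset.sum_congr rfl fun i _ => by rw [hiso i], Finset.sum_const, Finset.card_univ,
      nsmul_eq_mul]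
  simpa [hs] using h

/-- THE LEVER in the crux's own vocabulary (`QReg n → ℂ`, `normSq`, unitary matrices, the
`star _ ⬝ᵥ _` Gram condition): unitaries `U i` with `U i ψ` ORTHONORMAL and `U i φ ∈ W` force
`#ι − dim W ≤ #ι · normSq (ψ − φ)`. For crux 1246: `U` = the one-per-block Clifford monomials
`c_S` (`#ι = C(t,K)·8^K`), `ψ = |M⟩^{⊗t}`, `φ = Σ aᵢ gᵢ`, `W = Σᵢ span{c_T gᵢ : |T| = K}`
(`dim W ≤ r·D_K(4t)`). -/
theorem subflattening_bound_qreg {n : ℕ} {ι : Type*} [Fintype ι] [DecidableEq ι]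
    (U : ι → Matrix (Literature.Computability.Cryptography.QReg n)
      (Literature.Computability.Cryptography.QReg n) ℂ)
    (hU : ∀ i, U i ∈ Matrix.unitaryGroup (Literature.Computability.Cryptography.QReg n) ℂ)
    (ψ φ : Literature.Computability.Cryptography.QReg n → ℂ)
    (horth : ∀ i j, star (U i *ᵥ ψ) ⬝ᵥ (U j *ᵥ ψ) = if i = j then (1 : ℂ) else 0)
    (W : Submodule ℂ (Literature.Computability.Cryptography.QReg n → ℂ))
    (hφ : ∀ i, U i *ᵥ φ ∈ W) :
    (Fintype.card ι : ℝ) - Module.finrank ℂ W ≤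
      Fintype.card ι * Literature.Computability.Cryptography.normSq (ψ - φ) := by
  let V := Literature.Computability.Cryptography.QReg n → ℂ
  let e : V ≃ₗ[ℂ] EuclideanSpace ℂ (Literature.Computability.Cryptography.QReg n) :=
    (WithLp.linearEquiv 2 ℂ V).symm
  let u : ι → EuclideanSpace ℂ (Literature.Computability.Cryptography.QReg n) :=
    fun i => WithLp.toLp 2 (U i *ᵥ ψ)
  let w : ι → EuclideanSpace ℂ (Literature.Computability.Cryptography.QReg n) :=
    fun i => WithLp.toLp 2 (U i *ᵥ φ)
  have hu : Orthonormal ℂ u := by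
    rw [orthonormal_iff_ite]
    intro i j
    change ⟪WithLp.toLp 2 (U i *ᵥ ψ), WithLp.toLp 2 (U j *ᵥ ψ)⟫_ℂ = _
    rw [EuclideanSpace.inner_toLp_toLp, dotProduct_comm, horth i j]
  let W' : Submodule ℂ (EuclideanSpace ℂ (Literature.Computability.Cryptography.QReg n)) :=
    W.map (e : V →ₗ[ℂ] EuclideanSpace ℂ (Literature.Computability.Cryptography.QReg n))
  have hW' : Module.finrank ℂ W' = Module.finrank ℂ W := LinearEquiv.finrank_map_eq e W
  have hw : ∀ i, w i ∈ W' := fun i => by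
    change e (U i *ᵥ φ) ∈ W'
    exact Submodule.mem_map_of_mem (hφ i)
  have h := bessel_deficiency u hu W' w hw
  rw [hW'] at h
  have hnormSq : ∀ v : V, Literature.Computability.Cryptography.normSq v = ‖WithLp.toLp 2 v‖ ^ 2 :=
    fun v => by rw [EuclideanSpace.norm_sq_eq]; rfl
  have hterm : ∀ i, ‖u i - w i‖ ^ 2 = Literature.Computability.Cryptography.normSq (ψ - φ) := by
    intro i
    change ‖WithLp.toLp 2 (U i *ᵥ ψ) - WithLp.toLp 2 (U i *ᵥ φ)‖ ^ 2 = _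
    rw [← WithLp.toLp_sub, ← Matrix.mulVec_sub, ← hnormSq,
      Literature.Computability.Cryptography.normSq_mulVec_of_mem_unitaryGroup (hU i)]
  have hs : ∑ i, ‖u i - w i‖ ^ 2 =
      Fintype.card ι * Literature.Computability.Cryptography.normSq (ψ - φ) := by
    rw [Finset.sum_congr rfl fun i _ => hterm i, Finset.sum_const, Finset.card_univ, nsmul_eq_mul]
  linarith [h, hs]

end Summit.QuantumAdvantage.QuantumAdvantage.Cruxes.FlatteningBoundRobust.BesselSubflattening
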